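import Summits.CriticalPhenomena.PercolationContinuityZ3.Theorems.FK.FKSharpnessOSSS
import Summits.CriticalPhenomena.PercolationContinuityZ3.Theorems.FK.RadiusDecayRate
import Literature.Probability.LatticeModels.FKIsingWiredCriticalPoint
import Literature.Probability.LatticeModels.IsingPlusEdwardsSokal
import Literature.Probability.LatticeModels.FKIsingAnnulusTopRect
import HarnessLib

/-!
# DRT's Theorem 1.2 (1) in its printed form `φ¹_{Λ_n,p,q}[0 ↔ ∂Λ_n] ≤ e^{−cn}` and the exponential decay of the
# Ising plus-boundary magnetisation `⟨σ_0⟩⁺_{Λ_n;β}` for every `β < β_c(d)`, `d ≥ 2`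

Claimed R42 (8)(c) in the cell INBOX at 2026-08-28T03:19:07Z by fkp-10a gen 352 (NEW CLAIM #3 of the gen), addressed to coordinator fk-4 g266 (seated 01:27Z 2026-08-28; R147 l.8265 + word l.8271: row FO-10a-g352f; its (κ) exhausted — «an Ising plus-state / magnetisation version = a NEW R42 (8)(c) claim»); lineage row FO-10a-g352p (self-suggested), package g352-drtforms, label PF-A.
Support file of the `fk-continuity` cell (lineage fkp-10a, `--supports stmt-CriticalPhenomena-4575`); builds on
p205010 (kernel theorem, internal audit signed; external expert review pending).  No definitions, no named facts,
no sorries; standard axioms.  Package `g352-drtforms` = NEW CLAIM #3 of gen 352 (R147 / l.8271: «an Ising plus-state /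
magnetisation version … = a NEW R42 (8)(c) claim»): Duminil-Copin–Raoufi–Tassion's Theorem 1.2 (1) in its printed
finite-volume form, the two-point connectivity decay in every direction for every FK-Gibbs measure, and the exponential
decay of the Ising plus-boundary box magnetisation for every `β < β_c(d)` — over the Literature's `thetaWiredBox` /
`isingCorr` and the lineage's `FKGibbs`; gated on FS-G `FKSharpnessOSSS` of row FO-10a-g352f.  UNCONDITIONAL; nothing here
touches FH / TP_FK / the `_r3` binders of the cell.

* `thetaWiredBox_lt_one` — `φ¹_{Λ_n,p,q}(0 ↔ ∂Λ_n) < 1` for `0 ≤ p < 1`, `q ≥ 1`, `n ≥ 1`;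
* `thetaWiredBox_two_mul_le_thetaBox` — `φ¹_{Λ_{2n}}(0 ↔ ∂Λ_{2n}) ≤ θ_n = φ¹_{Λ_{2n}}(0 ↔ ∂Λ_n)`;
* **`exists_exp_decay_thetaWiredBox_of_lt_rcCriticalProb`** — for `d ≥ 2`, `q ≥ 1`, `0 ≤ p < p_c(q)`:
  `∃ c > 0, ∀ n ≥ 1, φ¹_{Λ_n,p,q}[0 ↔ ∂Λ_n] ≤ e^{−cn}` for the wired measure OF THE BOX `Λ_n` ITSELF (the Literature's
  `thetaWiredBox d p q n`, whose infimum over `n` is `θ¹(p,q)`) — Duminil-Copin–Raoufi–Tassion's Theorem 1.2 (1) exactly as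
  printed; from `θ_{⌊n/2⌋} ≤ e^{−c⌊n/2⌋}` (`FKSharpnessOSSS.lean`), `φ¹_{Λ_n} ≤ φ¹_{Λ_{2k}}(0 ↔ ∂Λ_{2k}) ≤ θ_k` and the first box;
* **`FKGibbs.real_openConn_le_exp_of_lt_rcCriticalProb`** — for `d ≥ 2`, `q ≥ 1`, `0 ≤ p < p_c(q)` and EVERY FK-Gibbs
  measure `P`: `∃ c > 0, ∀ x, P(0 ↔ x) ≤ e^{c} e^{−c‖x‖_∞}` (two-point connectivity, all directions; first exit);
* **`ising_plusMagnetization_box_le_exp_of_lt_criticalBeta`** — for `d ≥ 2`, `0 ≤ β < β_c(d)`: `∃ c > 0, ∀ n,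
  ⟨σ_0⟩⁺_{Λ_n;β,0} ≤ e^{−c(n+1)}`: the plus-boundary magnetisation at the centre of `Λ_n` decays exponentially — DRT's Potts
  theorem (Thm 1.6 of arXiv:1705.03104) at `q = 2` in its own form `P⁺_{Λ_n,β}[σ_0 = +] − ½ = ½⟨σ_0⟩⁺_{Λ_n;β} ≤ e^{−cn}`
  (Aizenman–Barsky–Fernández 1987 for the Ising model), via the tree's wired/plus Edwards–Sokal identity
  `thetaWiredBox_succ_eq_isingCorr_plus` (`⟨σ_0⟩⁺_{Λ_n;β} = φ¹_{Λ_{n+1},1−e^{−2β},2}(0 ↔ ∂Λ_{n+1})`) and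
  `rcCriticalProb_two_eq_fkIsingParam_criticalBeta` (`p_c(2) = 1 − e^{−2β_c}`).  The two-point / free-state form of Ising
  sharpness (`⟨σ_0σ_x⟩^∅_β ≤ e^{−c‖x‖}` for `β < β_c`) is ALREADY the tree's
  `Literature.Probability.LatticeModels.twoPoint_exponentialDecay_of_lt_criticalBeta_holds` (Duminil-Copin–Tassion 2016 route)
  and is not restated; the plus-boundary finite-volume magnetisation bound here is the random-cluster (wired-arm) statement.
No definitions.

## References
* H. Duminil-Copin, A. Raoufi, V. Tassion, Ann. of Math. 189 (2019) 75–99, Thm 1.2 (1) and the Potts theorem (Thm 1.6 of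
  arXiv:1705.03104). [DuminilCopinRaoufiTassion2019]
* M. Aizenman, D. Barsky, R. Fernández, J. Stat. Phys. 47 (1987) 343–374. [AizenmanBarskyFernandezJSP1987]
* G. Grimmett, *The Random-Cluster Model*, Springer 2006, Thm (1.16) with (4.12)–(4.13), Prop. (5.11), §1.2 (1.2). [Grimmett2006]
-/

noncomputable section

namespace Summit.CriticalPhenomena.PercolationContinuityZ3.Theorems.FK

namespace MonotonicOSSS

open MeasureTheory Finset Function Filter Topology Set
open Literature.Probability.Percolation Literature.Probability.LatticeModels Literature.Barriers.CriticalPhenomena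
open Literature.Probability.Percolation.DCT16

variable {d : ℕ} {q : ℝ}

/-- `φ¹_{Λ_n,p,q}(0 ↔ ∂Λ_n) < 1` for `0 ≤ p < 1`, `q ≥ 1`, `n ≥ 1`: the empty configuration has positive weight and no arm.
[cite: Grimmett2006, §1.2 eq. (1.2) (positive weights); Prop. (5.11)] -/
theorem thetaWiredBox_lt_one {p : ℝ} (hp : p ∈ Set.Ico (0 : ℝ) 1) (hq : 1 ≤ q) {n : ℕ} (hn : 1 ≤ n) :
    thetaWiredBox d p q n < 1 := by
  have hq0 : 0 < q := one_pos.trans_le hq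
  refine (thetaWiredBox_anti d ⟨hp.1, hp.2.le⟩ hq hn).trans_lt ?_
  rw [thetaWiredBox_eq_general]
  refine rcMeasure_real_lt_one_of_empty_notMem _ ⟨hp.1, hp.2.le⟩ hp.2 hq0 _ ?_
  rintro ⟨y, hy, hreach⟩
  rw [openGraph, SimpleGraph.fromEdgeSet_empty, SimpleGraph.reachable_bot] at hreach
  exact boxOrigin_notMem_boxBoundary d 0 (hreach ▸ hy)

/-- `φ¹_{Λ_{2n},p,q}(0 ↔ ∂Λ_{2n}) ≤ θ_n(p) = φ¹_{Λ_{2n},p,q}(0 ↔ ∂Λ_n)` (`{0 ↔ ∂Λ_{2n}} ⊆ {0 ↔ ∂Λ_n}`).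
[cite: Grimmett2006, Prop. (5.11) (proof)] -/
theorem thetaWiredBox_two_mul_le_thetaBox (hd : 1 ≤ d) {p : ℝ} (hp : p ∈ Set.Icc (0 : ℝ) 1) (hq : 1 ≤ q) (n : ℕ) :
    thetaWiredBox d p q (2 * n) ≤ regionWiredReal d p q (box d (2 * n)) (siteToBoundary d n) := by
  have hq0 : 0 < q := one_pos.trans_le hq
  calc thetaWiredBox d p q (2 * n) = regionWiredReal d p q (box d (2 * n)) (siteToBoundary d (2 * n)) := by
        rw [← rcBoxLaw_true_real_siteToBoundary_self, regionWiredReal_box p q _ (measurableSet_siteToBoundary d _)]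
    _ = regionWiredReal d p q (box d (2 * n)) (armEvent 0 (2 * n)) := by rw [armEvent_zero]
    _ ≤ regionWiredReal d p q (box d (2 * n)) (armEvent 0 n) :=
        regionWiredReal_armEvent_anti hd hp hq0 _ _ (by omega)
    _ = regionWiredReal d p q (box d (2 * n)) (siteToBoundary d n) := by rw [armEvent_zero]

/-- **DRT's Theorem 1.2 (1) AS PRINTED**: for `d ≥ 2`, `q ≥ 1` and `0 ≤ p < p_c(q)` there is `c > 0` with
`φ¹_{Λ_n,p,q}[0 ↔ ∂Λ_n] ≤ e^{−cn}` for every `n ≥ 1` — the wired measure OF THE BOX `Λ_n` ITSELF (the Literature's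
`thetaWiredBox d p q n`, whose infimum over `n` is `θ¹(p,q)`), the strongest finite-volume form.
[cite: DuminilCopinRaoufiTassion2019, Thm 1.2 (1) ("for every n ≥ 1, φ¹_{Λ_n,p,q}[0 ↔ ∂Λ_n] ≤ exp(−c_p n)")] -/
theorem exists_exp_decay_thetaWiredBox_of_lt_rcCriticalProb (hd : 2 ≤ d) (hq : 1 ≤ q) {p : ℝ} (hp0 : 0 ≤ p)
    (hpc : p < rcCriticalProb d q) :
    ∃ c : ℝ, 0 < c ∧ ∀ n : ℕ, 1 ≤ n → thetaWiredBox d p q n ≤ Real.exp (-(c * n)) := by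
  have hd1 : 1 ≤ d := by omega
  have hpc1 : rcCriticalProb d q < 1 := rcCriticalProb_lt_one hd hq
  -- a strictly positive parameter `p ≤ p' < p_c(q)`
  set p' : ℝ := (p + rcCriticalProb d q) / 2 with hp'
  have hp'0 : 0 < p' := by rw [hp']; linarith [rcCriticalProb_pos hd1 hq]
  have hp'c : p' < rcCriticalProb d q := by rw [hp']; linarith
  have hpp' : p ≤ p' := by rw [hp']; linarith
  have hpI : p ∈ Set.Icc (0 : ℝ) 1 := ⟨hp0, (hpp'.trans (hp'c.trans hpc1).le)⟩
  have hp'I : p' ∈ Set.Icc (0 : ℝ) 1 := ⟨hp'0.le, (hp'c.trans hpc1).le⟩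
  obtain ⟨c, hc, hdec⟩ := exists_exp_decay_thetaBox_of_lt_rcCriticalProb hd hq hp'0 hp'c
  -- the first box: `φ¹_{Λ_1,p',q}(0 ↔ ∂Λ_1) ≤ max(·, 1/2) = e^{−c₁}` with `c₁ > 0`
  set t : ℝ := max (thetaWiredBox d p' q 1) (1 / 2) with ht
  have ht1 : t < 1 := max_lt (thetaWiredBox_lt_one ⟨hp'0.le, hp'c.trans hpc1⟩ hq le_rfl) (by norm_num)
  have ht0 : 0 < t := lt_max_of_lt_right (by norm_num)
  refine ⟨min (c / 4) (-Real.log t), lt_min (by linarith) (neg_pos.2 (Real.log_neg ht0 ht1)), fun n hn => ?_⟩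
  have hmono : thetaWiredBox d p q n ≤ thetaWiredBox d p' q n := thetaWiredBox_mono_left d hpI hp'I hpp' hq n
  refine hmono.trans ?_
  rcases Nat.lt_or_ge n 2 with hn2 | hn2
  · -- `n = 1`
    obtain rfl : n = 1 := by omega
    calc thetaWiredBox d p' q 1 ≤ t := le_max_left _ _
      _ = Real.exp (-(-Real.log t * 1)) := by rw [mul_one, neg_neg, Real.exp_log ht0]
      _ ≤ Real.exp (-(min (c / 4) (-Real.log t) * (1 : ℕ))) := by
          rw [Nat.cast_one]; exact Real.exp_le_exp.2 (neg_le_neg (mul_le_mul_of_nonneg_right (min_le_right _ _) zero_le_one))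
  · -- `n ≥ 2`: `φ¹_{Λ_n} ≤ φ¹_{Λ_{2k}}(0 ↔ ∂Λ_{2k}) ≤ θ_k(p') ≤ e^{−ck}`, `k = ⌊n/2⌋ ≥ n/4`
    set k : ℕ := n / 2 with hk
    have hk1 : 1 ≤ k := by omega
    have hkn : 2 * k ≤ n := by omega
    have hk4 : (n : ℝ) ≤ 4 * k := by
      have : n ≤ 4 * k := by omega
      exact_mod_cast this
    calc thetaWiredBox d p' q n ≤ thetaWiredBox d p' q (2 * k) := thetaWiredBox_anti d hp'I hq hkn
      _ ≤ regionWiredReal d p' q (box d (2 * k)) (siteToBoundary d k) := thetaWiredBox_two_mul_le_thetaBox hd1 hp'I hq k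
      _ ≤ Real.exp (-(c * k)) := hdec k hk1
      _ ≤ Real.exp (-(min (c / 4) (-Real.log t) * n)) := by
          refine Real.exp_le_exp.2 (neg_le_neg ?_)
          calc min (c / 4) (-Real.log t) * n ≤ (c / 4) * n := mul_le_mul_of_nonneg_right (min_le_left _ _) (Nat.cast_nonneg n)
            _ ≤ (c / 4) * (4 * k) := mul_le_mul_of_nonneg_left hk4 (by linarith)
            _ = c * k := by ring

/-- **EXPONENTIAL DECAY OF THE TWO-POINT CONNECTIVITY IN EVERY DIRECTION, FOR EVERY FK-GIBBS MEASURE**: for `d ≥ 2`,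
`q ≥ 1`, `0 ≤ p < p_c(q)` and every FK-Gibbs measure `P` at `(p,q)` there is `c > 0` with
`P(0 ↔ x) ≤ e^{c} · e^{−c‖x‖_∞}` for all `x ∈ ℤ^d` (first exit: `{0 ↔ x} ⊆ {0 ↔ ∂Λ_{‖x‖_∞−1}}`, and the radius tail of
`FKSharpnessOSSS.lean`). [cite: DuminilCopinRaoufiTassion2019, Thm 1.2 (1) (exponential decay of connectivities below p_c); Grimmett2006, Thm (5.86)(c) form] -/
theorem FKGibbs.real_openConn_le_exp_of_lt_rcCriticalProb (hd : 2 ≤ d) (hq : 1 ≤ q) {p : ℝ} (hp0 : 0 ≤ p)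
    (hpc : p < rcCriticalProb d q) {P : Measure (BondConfig (Site d))} (hP : FKGibbs d p q P) :
    ∃ c : ℝ, 0 < c ∧ ∀ x : Site d,
      P.real (openConn (0 : Site d) x) ≤ Real.exp c * Real.exp (-(c * OneArmOSSS.boxNorm x)) := by
  obtain ⟨c, hc, h⟩ := FKGibbs.exists_exp_decay_real_siteToBoundary_of_lt_rcCriticalProb hd hq hp0 hpc hP
  haveI := hP.isProbabilityMeasure
  refine ⟨c, hc, fun x => ?_⟩
  rcases Nat.lt_or_ge (OneArmOSSS.boxNorm x) 2 with h2 | h2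
  · -- `‖x‖_∞ ≤ 1`: the trivial bound `P ≤ 1 ≤ e^{c(1 − ‖x‖_∞)}`
    calc P.real (openConn (0 : Site d) x) ≤ 1 := measureReal_le_one
      _ ≤ Real.exp c * Real.exp (-(c * OneArmOSSS.boxNorm x)) := by
          rw [← Real.exp_add]
          refine Real.one_le_exp (by
            have : (OneArmOSSS.boxNorm x : ℝ) ≤ 1 := by exact_mod_cast (by omega : OneArmOSSS.boxNorm x ≤ 1)
            nlinarith)
  · have hx : x ∉ box d (OneArmOSSS.boxNorm x - 1) := by
      rw [OneArmOSSS.mem_box_iff_boxNorm_le]; omega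
    have h1 : 1 ≤ OneArmOSSS.boxNorm x := by omega
    calc P.real (openConn (0 : Site d) x) ≤ P.real (siteToBoundary d (OneArmOSSS.boxNorm x - 1)) :=
          real_openConn_le_real_siteToBoundary_of_notMem hP.ae_subset_edgeSet hx
      _ ≤ Real.exp (-(c * ((OneArmOSSS.boxNorm x - 1 : ℕ) : ℝ))) := h _ (by omega)
      _ = Real.exp c * Real.exp (-(c * OneArmOSSS.boxNorm x)) := by
          rw [← Real.exp_add, Nat.cast_sub h1, Nat.cast_one]; ring_nf

/-- **SHARPNESS FOR THE ISING MODEL IN DRT's MAGNETISATION FORM** (their Potts theorem, Thm 1.6 of arXiv:1705.03104, at `q = 2`: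
`0 ≤ P⁺_{Λ_n,β}[σ_0 = +] − ½ ≤ e^{−cn}`, i.e. the plus-boundary magnetisation at the centre decays): for `d ≥ 2` and
`0 ≤ β < β_c(d)` there is `c > 0` with `⟨σ_0⟩⁺_{Λ_n;β,0} ≤ e^{−c(n+1)}` for every `n` — by the wired/plus Edwards–Sokal identity
`⟨σ_0⟩⁺_{Λ_n;β} = φ¹_{Λ_{n+1},1−e^{−2β},2}(0 ↔ ∂Λ_{n+1})` (the tree's `thetaWiredBox_succ_eq_isingCorr_plus`) and the previous theorem.
[cite: DuminilCopinRaoufiTassion2019, Thm 1.6 of arXiv:1705.03104 (q = 2: plus-state magnetisation decays exponentially for β < β_c); cf. Aizenman–Barsky–Fernández 1987] -/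
theorem ising_plusMagnetization_box_le_exp_of_lt_criticalBeta (hd : 2 ≤ d) {β : ℝ} (hβ0 : 0 ≤ β) (hβc : β < criticalBeta d) :
    ∃ c : ℝ, 0 < c ∧ ∀ n : ℕ,
      isingCorr (zdGraph d) (box d n) β 0 .plus {0} ≤ Real.exp (-(c * (n + 1))) := by
  have hpc : fkIsingParam β < rcCriticalProb d 2 := by
    rw [rcCriticalProb_two_eq_fkIsingParam_criticalBeta hd]; exact fkIsingParam_strictMono hβc
  obtain ⟨c, hc, h⟩ := exists_exp_decay_thetaWiredBox_of_lt_rcCriticalProb hd (by norm_num : (1 : ℝ) ≤ 2)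
    (fkIsingParam_mem_Icc hβ0).1 hpc
  refine ⟨c, hc, fun n => ?_⟩
  rw [← thetaWiredBox_succ_eq_isingCorr_plus (by omega) hβ0 n]
  exact_mod_cast h (n + 1) (by omega)

end MonotonicOSSS

end Summit.CriticalPhenomena.PercolationContinuityZ3.Theorems.FK
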